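import Literature.AlgebraicGeometry.ModuliOfAbelianVarieties.SiegelModuliComplexUniformisation
import Literature.AlgebraicGeometry.ModuliOfAbelianVarieties.SiegelFineModuliDeformationBridge
import Literature.AlgebraicGeometry.ModuliOfAbelianVarieties.SiegelShimuraSet
import HarnessLib

/-!
# The Hecke link between two levels of the Siegel modular variety: the lattice condition `QuotientAdapted` and the
# linked-class relation `HeckeLinked` ([Milne 2005] §6 Thm. 6.11, §5 Hecke operators `T(g)` Def. 5.14; [Deligne 1971] 4.11–4.12)

Topic `AlgebraicGeometry/ModuliOfAbelianVarieties`; namespace `Literature.AlgebraicGeometry.ModuliOfAbelianVarieties`.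
DEFINITIONS ONLY (two `Prop`-valued `def`s); no theorem, no named fact, no instance, no notation, no `sorry`.

[Milne2005ShimuraVarieties] Thm. 6.11 (p. 74): the Siegel double coset `G(ℚ)\X × G(𝔸_f)/K` classifies triples
`(A, s, ηK)`; the Hecke operator of `g ∈ G(𝔸_f)` (§5 p. 58, the maps `T(g) : Sh_K → Sh_{g⁻¹Kg}`, `[x, a] ↦ [x, ag]`, Def. 5.14) is, in this
moduli language, the ISOGENY `A ↦ A/η(gΛ̂/Λ̂)` ([Deligne1971TravauxShimura] 4.11: «l'action de `G(𝔸_f)` … se décrit en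
termes d'isogénies»).  For the Siegel tower `𝓜_{g,δ,N}` with classes read through `[J(Z), r K_δ(N)]` (★ `IsAdmissibleAt`,
★ `SiegelShimuraSet.baseChangeEquiv`), this file records the two predicates under which a rational lattice map
`γ ∈ GL_{2g}(ℚ)` links a level-`N′` class `y` of type `δ′` to a level-`N` class `x` of type `δ`:

* `QuotientAdapted δ δ′ N N′ r r′ γ` — the LATTICE CONDITION (pure adelic arithmetic on the representatives `r ∈ GSp_δ(𝔸_f)`,
  `r′ ∈ GSp_{δ′}(𝔸_f)`): (QA0) `N ∣ N′`; (QA5) `r′ = r·k` for some `k ∈ K_δ(N)` (as finite-adelic matrices); (QA1)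
  `γ Λ_{r′} ⊆ Λ_r` (the quotient lattice `γ⁻¹Λ_r` contains the source lattice `Λ_{r′} = V ∩ r′ẑ^{2g}`, ★ `latticeOfGL`); (QA2)
  `N′•γ⁻¹Λ_r ⊆ N•Λ_{r′}` (the kernel `γ⁻¹Λ_r/Λ_{r′}` and the level-`N` division points of the quotient live inside the
  level-`N′` division points of the source); (QA4) `(γ − 1)Λ_r ⊆ N•Λ_r` (`γ ≡ 1 (mod N)` on `Λ_r`, so the quotient's level-`N`
  structure `ψ ∘ η′^{N′/N}` reads through `r`); (QA3) `ᵗγ E_δ γ = ν E_{δ′}` with `ν > 0` (`γ` is a similitude of the standard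
  forms ★ `typeFormOver`, so complex structures and polarisation types transport).  [Milne 2005] §6 p. 75 «`aK ↦ ηK`»;
  [Deligne 1971] 4.12 (b).
* `HeckeLinked 𝓜 𝓜′ r′ y x` — the LINKED-CLASS RELATION between a complex point `y` of the level-`N′` variety (read through
  `r′`) and a complex point `x` of the level-`N` variety: there are an open self-map `θ` of `𝔥_g`, a rational `γ` with
  `J(θ Z) = γ_ℝ J(Z) γ_ℝ⁻¹` (★ `jOfSiegel`, ★ `conjJ`), and a principal representative `r ∈ K_δ(1)` with `δ′ = δ` and
  `QuotientAdapted δ δ′ N N′ r r′ γ`, such that every `(Z, r′)`-admissible triple of class `y` (★ `IsAdmissibleAt`, classes via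
  ★ `AlgPoints.baseChangeEquiv (algebraMap ℚ ℂ)` of ★ `classifyingMap (specOver ℚ ℂ)`) has a `(θ Z, r)`-admissible partner of
  class `x` — the pointwise shadow of the Hecke correspondence `𝓜_{N′} ← 𝓜_{Γ′} → 𝓜_N` ([Milne 2005] §5 p. 58 Def. 5.14;
  [MumfordFogartyKirwan1994] Ch. 7 §3 for the algebraic quotient).

Cell hodgecm-mathlib (D-0151), Hecke-link line of the equidimensionality crux; consumers: the infinitesimal Hecke transfer
and the isogeny-quotient map.  HC_CM is proved only modulo the 7 printed citations until rung 0 closes; this file asserts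
nothing.

## References
* [Milne2005ShimuraVarieties] J. S. Milne, *Introduction to Shimura varieties* (2005), §5 p. 58 (the maps `T(g) : Sh_K →
  Sh_{g⁻¹Kg}`, Def. 5.14), §6 Thm. 6.11 pp. 74–75 (the Siegel modular variety classifies `(A, s, ηK)`).
* [Deligne1971TravauxShimura] P. Deligne, *Travaux de Shimura*, Sém. Bourbaki 389 (1971), 4.11–4.12 pp. 148–149.
* [MumfordFogartyKirwan1994] D. Mumford, J. Fogarty, F. Kirwan, *Geometric Invariant Theory*, 3rd ed. (1994), Ch. 7 §3
  (p. 139).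
-/


noncomputable section

open CategoryTheory AlgebraicGeometry Matrix
open Literature.AlgebraicGeometry.Motives (SchemeOver ComplexPoints AlgPoints specOver)
open Literature.AlgebraicGeometry.AbelianSchemes (PolarizedAbelianSchemeWithLevel)
open Literature.NumberTheory.Automorphic (siegelUpperHalfSpace)
open Literature.NumberTheory.Adeles (latticeOfGL)

namespace Literature.AlgebraicGeometry.ModuliOfAbelianVarieties

open SiegelModuli

/-- **`QuotientAdapted`** — the lattice condition of the Hecke link (see the module docstring): (QA0) `N ∣ N′`; (QA5) `r′ = r·k`
for some `k ∈ K_δ(N)` (as finite-adelic matrices: the source and target representatives agree modulo `K_δ(N)`, so level-`N`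
readings through `r′` and through `r` coincide); (QA1) `Λ_{r′} ⊆ γ⁻¹Λ_r`,
(QA2) `N′•γ⁻¹Λ_r ⊆ N•Λ_{r′}`, (QA4) `(γ − 1)Λ_r ⊆ N•Λ_r` (`γ ≡ 1 (mod N)` on `Λ_r`: the quotient's UNTWISTED level-`N`
structure `ψ ∘ η′^{N′/N}` then reads at the representative `r` through the `γ`-moved marking), (QA3) `ᵗγ E_δ γ = ν E_{δ′}`
with `ν > 0`.  Pure adelic/lattice arithmetic on
`(δ, δ′, N, N′, r, r′, γ)`; a Hecke move meets it by taking `N′ = N·m` with `m` divisible by the denominators of `γ` and `γ⁻¹`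
(e.g. `m := ν(γ)` when `γ` is integral with `m•γ⁻¹` integral).
[cite: Milne2005ShimuraVarieties, §6 Thm. 6.11 p. 74 and p. 75] [cite: Deligne1971TravauxShimura, 4.11–4.12 pp. 148–149] -/
def QuotientAdapted {g : ℕ} (δ δ' : Fin g → ℕ) (N N' : ℕ) (r : gspFinAdelic δ) (r' : gspFinAdelic δ')
    (γ : GL (Fin g ⊕ Fin g) ℚ) : Prop :=
  N ∣ N' ∧
  (∃ k : gspFinAdelic δ, k ∈ principalLevelSubgroup δ N ∧
      (r' : GL (Fin g ⊕ Fin g) finAdeleQ) = (r : GL (Fin g ⊕ Fin g) finAdeleQ) * (k : GL (Fin g ⊕ Fin g) finAdeleQ)) ∧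
  (∀ v : Fin g ⊕ Fin g → ℚ, v ∈ latticeOfGL (r' : GL (Fin g ⊕ Fin g) finAdeleQ) →
      (γ : Matrix (Fin g ⊕ Fin g) (Fin g ⊕ Fin g) ℚ) *ᵥ v ∈ latticeOfGL (r : GL (Fin g ⊕ Fin g) finAdeleQ)) ∧
  (∀ w : Fin g ⊕ Fin g → ℚ, w ∈ latticeOfGL (r : GL (Fin g ⊕ Fin g) finAdeleQ) →
      ∃ v : Fin g ⊕ Fin g → ℚ, v ∈ latticeOfGL (r' : GL (Fin g ⊕ Fin g) finAdeleQ) ∧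
        (N' : ℚ) • (((γ⁻¹ : GL (Fin g ⊕ Fin g) ℚ) : Matrix (Fin g ⊕ Fin g) (Fin g ⊕ Fin g) ℚ) *ᵥ w) = (N : ℚ) • v) ∧
  (∀ w : Fin g ⊕ Fin g → ℚ, w ∈ latticeOfGL (r : GL (Fin g ⊕ Fin g) finAdeleQ) →
      ∃ w' : Fin g ⊕ Fin g → ℚ, w' ∈ latticeOfGL (r : GL (Fin g ⊕ Fin g) finAdeleQ) ∧
        (γ : Matrix (Fin g ⊕ Fin g) (Fin g ⊕ Fin g) ℚ) *ᵥ w - w = (N : ℚ) • w') ∧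
  ∃ ν : ℚ, 0 < ν ∧
    (γ : Matrix (Fin g ⊕ Fin g) (Fin g ⊕ Fin g) ℚ)ᵀ * typeFormOver δ ℚ * (γ : Matrix (Fin g ⊕ Fin g) (Fin g ⊕ Fin g) ℚ) =
      ν • typeFormOver δ' ℚ

/-- **`HeckeLinked`** — the linked-class relation of the Hecke correspondence between two levels: the point `y` of
`𝓜′_ℂ` READ AT `r′` is linked to the point `x` of `𝓜_ℂ` when there are an open self-map `θ` of `𝔥_g`, a rational lattice
map `γ` with `J(θ Z) = γ·J(Z)·γ⁻¹` (so `θ` is the Möbius move of `γ` between the type-`δ′` and type-`δ` normal forms), a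
principal target representative `r ∈ K_δ(1)` with `δ′ = δ` (the tower keeps the type; stated as a conjunct so no transport
appears in the text) and `QuotientAdapted δ δ′ N N′ r r′ γ`, AND the analytic cut: every
`(Z, r′)`-admissible triple of class `y` has a `(θ Z, r)`-admissible partner of class `x` (the classifying points read through
`AlgPoints.baseChangeEquiv`). [cite: Milne2005ShimuraVarieties, §5 p. 58 (Def. 5.14) and §6 Thm. 6.11 p. 74 and p. 75]
[cite: MumfordFogartyKirwan1994, Ch. 7 §3 (p. 139)] -/
def HeckeLinked {g N N' : ℕ} {δ δ' : Fin g → ℕ} (𝓜 : SiegelFineModuliScheme g N δ)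
    (𝓜' : SiegelFineModuliScheme g N' δ') (r' : gspFinAdelic δ')
    (y : ComplexPoints ((Motives.baseChange ℚ ℂ).obj 𝓜'.M)) (x : ComplexPoints ((Motives.baseChange ℚ ℂ).obj 𝓜.M)) :
    Prop :=
  haveI : IsLocallyNoetherian (specOver ℚ ℂ).left := inferInstanceAs (IsLocallyNoetherian (Spec (CommRingCat.of ℂ)))
  ∃ (hδ : IsPolarizationType δ) (hδ' : IsPolarizationType δ')
    (θ : siegelUpperHalfSpace g → siegelUpperHalfSpace g) (_ : IsOpenMap θ)
    (γ : GL (Fin g ⊕ Fin g) ℚ)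
    (_ : ∀ Z : siegelUpperHalfSpace g,
      jOfSiegel δ ((θ Z : siegelUpperHalfSpace g) : Matrix (Fin g) (Fin g) ℂ) =
        conjJ (Matrix.GeneralLinearGroup.map (algebraMap ℚ ℝ) γ) (jOfSiegel δ' ((Z : siegelUpperHalfSpace g) : Matrix (Fin g) (Fin g) ℂ)))
    (r : gspFinAdelic δ) (_ : r ∈ principalLevelSubgroup δ 1),
    δ' = δ ∧ QuotientAdapted δ δ' N N' r r' γ ∧
    ∀ (Z : siegelUpperHalfSpace g) (P' : PolarizedAbelianSchemeWithLevel g N' δ' (specOver ℚ ℂ).left),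
      IsAdmissibleAt hδ' r' Z.1 Z.2 P' →
      AlgPoints.baseChangeEquiv (algebraMap ℚ ℂ) 𝓜'.M (𝓜'.classifyingMap (specOver ℚ ℂ) P') = y →
      ∃ P : PolarizedAbelianSchemeWithLevel g N δ (specOver ℚ ℂ).left,
        IsAdmissibleAt hδ r (θ Z).1 (θ Z).2 P ∧
        AlgPoints.baseChangeEquiv (algebraMap ℚ ℂ) 𝓜.M (𝓜.classifyingMap (specOver ℚ ℂ) P) = x

end Literature.AlgebraicGeometry.ModuliOfAbelianVarieties

end
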